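import Literature.NumberTheory.LFunctions.ZetaClassicalRegionBounds
import Literature.NumberTheory.LFunctions.ZetaEulerLowerBound
import Mathlib.Analysis.Complex.BranchLogRoot
import Mathlib.Analysis.Convex.Contractible
import Mathlib.NumberTheory.EulerProduct.DirichletLSeries
import HarnessLib

/-!
# A holomorphic `log ((s−1)ζ(s))` on the classical zero-free region, and the complex powers `ζ(s)^μ`

Topic `Literature/NumberTheory/LFunctions` (T-ANT), family RH. Everything here is PROVED; the file
has definitions (the region, the logarithm, the powers) but no named facts.

The Selberg–Delange method and Montgomery's 1983 construction of zeros of the sections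
`ζ_N(s) = ∑_{n ≤ N} n^{−s}` far to the right (the barrier `Montgomery1983_theorem` of
`Literature/Barriers/RiemannHypothesis/TuranPartialSums.lean`) work with complex powers
`ζ(s)^z = exp(z log ζ(s))` continued to the left of `σ = 1` inside the de la Vallée Poussin region,
where `log ζ(s)` has a logarithmic branch point at `s = 1` ("we write `f*(s) = Π_k ζ(s−ik)^{b̂(k)}` …
by (17) this product is uniformly convergent for `σ ≥ 1 − c₁/log τ`", Montgomery 1983, §3; Tenenbaum,
*Introduction to analytic and probabilistic number theory*, II.5 §5.1, the function `Z(s;z)`).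
This file builds that object once and for all from the tree's zero-free region with bounds
(`Literature.NumberTheory.LFunctions.ZetaClassicalRegion.exists_zeroFreeRegion_bounds`):

* `zfrRegion` — the open region `Ω = {s : Re s > 1 − 4c̄/log(|Im s| + 3)}` for the tree's absolute
  constant `c̄ = zfrConst` (`0 < c̄ ≤ 1/100`); it contains the closed half-plane `Re s ≥ 1`, is
  star-convex about `2`, hence simply connected, and `ζ₁(s) = (s − 1)ζ(s)` (Mathlib's entire
  `riemannZeta₁`) does not vanish on it (`riemannZeta₁_ne_zero_of_mem_zfrRegion`).
* `logZeta₁` — THE holomorphic branch of `log ζ₁` on `Ω` normalised by `logZeta₁ 2 = log ζ(2) ∈ ℝ`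
  (`differentiableOn_logZeta₁`, `exp_logZeta₁`); on `Re s > 1` it is the Euler-product logarithm plus
  `Log(s − 1)`: `logZeta₁ s = ∑_p −Log(1 − p^{−s}) + Log(s − 1)` (`logZeta₁_eq_tsum_add_log`), and it is
  real on the real points of `Ω` (`logZeta₁_ofReal_im`).
* `zetaCpow μ s = exp(μ · logZeta₁ s) · (s − 1)^{−μ}` (`μ : ℝ`, principal power) — the branch of
  `ζ(s)^μ` on `Ω` slit along `(−∞, 1]`: holomorphic there (`differentiableOn_zetaCpow`), equal to
  `exp(μ ∑_p −Log(1 − p^{−s}))` for `Re s > 1` (`zetaCpow_eq_exp_tsum`), of modulus `‖ζ(s)‖^μ`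
  (`norm_zetaCpow`), hence bounded in `Ω` by powers of `log(|t| + 3)` and of `1/|s − 1|`
  (`norm_zetaCpow_le_of_nonneg`, `norm_zetaCpow_le_of_nonpos`), with the two boundary values along
  the cut `s = 1 − u`, `u > 0`: `e^{∓iπμ} u^{−μ} ζ₁(1 − u)^μ` from above/below
  (`tendsto_zetaCpow_upper`, `tendsto_zetaCpow_lower`).

Generic lemmas of independent use: a continuous logarithm of a holomorphic function is holomorphic
(`differentiableOn_of_exp_eq`), and two continuous logarithms on a preconnected set agreeing at a
point agree (`eqOn_of_exp_eq_exp`).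

## References

* [Tenenbaum2015] G. Tenenbaum, *Introduction to analytic and probabilistic number theory*, 3rd ed.,
  AMS GSM 163, II.5 §5.1 (the powers `ζ(s)^z` in the zero-free region), II.3 §3.8–3.9.
* [Montgomery1983] H. L. Montgomery, *Zeros of approximations to the zeta function*, Studies in Pure
  Mathematics (Birkhäuser 1983), 497–506, §3 ((14)–(17), `f*(s) = Π ζ(s − ik)^{b̂(k)}`).
* [Titchmarsh1986] E. C. Titchmarsh, *The theory of the Riemann zeta-function*, 2nd ed., §3.11
  ((3.11.7)–(3.11.8): `ζ`, `1/ζ`, `ζ'/ζ ≪ log t` in `σ ≥ 1 − A/log t`).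
-/

noncomputable section

open Complex Set Filter Topology Metric

namespace Literature.NumberTheory.LFunctions

/-! ### Continuous logarithms: uniqueness and holomorphy -/

/-- A continuous function `g` on a preconnected set with `exp (g s) = 1` everywhere and `g a = 0`
at one point vanishes identically (its imaginary part is a continuous function into `2πℤ`).
[folklore] -/
theorem eqOn_zero_of_exp_eq_one {S : Set ℂ} (hS : IsPreconnected S) {g : ℂ → ℂ}
    (hg : ContinuousOn g S) (h1 : ∀ s ∈ S, exp (g s) = 1) {a : ℂ} (ha : a ∈ S) (hga : g a = 0) :
    EqOn g 0 S := by
  intro s hs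
  obtain ⟨n, hn⟩ := exp_eq_one_iff.1 (h1 s hs)
  -- the continuous function `Im g / (2π)` takes integer values on `S`
  have hint : ∀ z ∈ S, ∃ m : ℤ, (g z).im / (2 * Real.pi) = m := by
    intro z hz
    obtain ⟨m, hm⟩ := exp_eq_one_iff.1 (h1 z hz)
    refine ⟨m, ?_⟩
    rw [hm]
    simp only [mul_im, intCast_re, intCast_im, mul_re, re_ofNat, ofReal_re, im_ofNat, ofReal_im,
      mul_zero, sub_zero, I_re, I_im, mul_one, zero_mul, add_zero, mul_im]
    field_simp
  have hφ : ContinuousOn (fun z ↦ (g z).im / (2 * Real.pi)) S :=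
    (continuous_im.comp_continuousOn hg).div_const _
  -- a value strictly between two distinct integer values would be a half-integer value
  have key : ∀ {x y : ℂ} {p q : ℤ}, x ∈ S → y ∈ S → (g x).im / (2 * Real.pi) = p →
      (g y).im / (2 * Real.pi) = q → p < q → False := by
    intro x y p q hx hy hp hq hpq
    have hsub := hS.intermediate_value hx hy hφ
    have hmem : ((p : ℝ) + 1 / 2) ∈ Icc ((g x).im / (2 * Real.pi)) ((g y).im / (2 * Real.pi)) := by
      rw [hp, hq]
      constructor
      · linarith
      · have : (p : ℝ) + 1 ≤ q := by exact_mod_cast hpq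
        linarith
    obtain ⟨z, hz, hzval⟩ := hsub hmem
    obtain ⟨m, hm⟩ := hint z hz
    have hzval' : (g z).im / (2 * Real.pi) = p + 1 / 2 := hzval
    rw [hm] at hzval'
    have h2 : (2 : ℝ) * m = 2 * p + 1 := by linarith
    have h3 : (2 * m : ℤ) = 2 * p + 1 := by exact_mod_cast h2
    omega
  obtain ⟨m, hm⟩ := hint s hs
  have hima : (g a).im / (2 * Real.pi) = ((0 : ℤ) : ℝ) := by rw [hga]; simp
  by_contra hne
  have hm0 : m ≠ 0 := by
    rintro rfl
    apply hne
    have hre : (g s).re = 0 := by rw [hn]; simp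
    have him0 : (g s).im = 0 := by
      have h := hm
      rw [Int.cast_zero, div_eq_zero_iff] at h
      rcases h with h | h
      · exact h
      · exfalso; exact absurd h (by positivity)
    show g s = 0
    exact Complex.ext (by simpa using hre) (by simpa using him0)
  rcases lt_or_gt_of_ne hm0 with hlt | hgt
  · exact key hs ha hm hima hlt
  · exact key ha hs hima hm hgt

/-- **Uniqueness of continuous logarithms**: two continuous functions `f`, `g` on a preconnected
set with `exp ∘ f = exp ∘ g` there and `f a = g a` at one point coincide. [folklore] -/
theorem eqOn_of_exp_eq_exp {S : Set ℂ} (hS : IsPreconnected S) {f g : ℂ → ℂ}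
    (hf : ContinuousOn f S) (hg : ContinuousOn g S) (he : ∀ s ∈ S, exp (f s) = exp (g s))
    {a : ℂ} (ha : a ∈ S) (hfa : f a = g a) : EqOn f g S := by
  have h := eqOn_zero_of_exp_eq_one hS (hf.sub hg) (fun s hs ↦ ?_) ha (by simp [hfa])
  · intro s hs
    have := h hs
    simp only [Pi.sub_apply, Pi.zero_apply, sub_eq_zero] at this
    exact this
  · show exp (f s - g s) = 1
    rw [exp_sub, he s hs, div_self (exp_ne_zero _)]

/-- **A continuous logarithm of a holomorphic function is holomorphic.** If `Φ` is holomorphic on an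
open set `U`, `f` is continuous on `U` and `exp (f s) = Φ s` on `U`, then `f` is holomorphic on `U`
(locally `f = f(s₀) + Log(Φ/Φ(s₀))`). [folklore] -/
theorem differentiableOn_of_exp_eq {U : Set ℂ} (hU : IsOpen U) {Φ f : ℂ → ℂ}
    (hΦ : DifferentiableOn ℂ Φ U) (hf : ContinuousOn f U) (he : ∀ s ∈ U, exp (f s) = Φ s) :
    DifferentiableOn ℂ f U := by
  intro s₀ hs₀
  have hΦ0 : Φ s₀ ≠ 0 := by rw [← he s₀ hs₀]; exact exp_ne_zero _
  -- near `s₀`, `Φ s / Φ s₀` lies in the slit plane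
  have hΦc : ContinuousAt Φ s₀ := (hΦ.differentiableAt (hU.mem_nhds hs₀)).continuousAt
  have hfc : ContinuousAt f s₀ := hf.continuousAt (hU.mem_nhds hs₀)
  have hq : ContinuousAt (fun s ↦ Φ s / Φ s₀) s₀ := hΦc.div_const _
  have hq1 : (fun s ↦ Φ s / Φ s₀) s₀ = 1 := div_self hΦ0
  have hslit : ∀ᶠ s in 𝓝 s₀, Φ s / Φ s₀ ∈ slitPlane := by
    have : slitPlane ∈ 𝓝 ((fun s ↦ Φ s / Φ s₀) s₀) := by
      rw [hq1]; exact isOpen_slitPlane.mem_nhds one_mem_slitPlane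
    exact hq this
  -- and `f s − f s₀` is close to `0`
  have hsmall : ∀ᶠ s in 𝓝 s₀, ‖f s - f s₀‖ < 1 := by
    have hc : ContinuousAt (fun s ↦ ‖f s - f s₀‖) s₀ := (hfc.sub continuousAt_const).norm
    exact hc.eventually (gt_mem_nhds (show ‖f s₀ - f s₀‖ < 1 by simp))
  obtain ⟨r, hr, hball⟩ : ∃ r > 0, ball s₀ r ⊆ U ∩ {s | Φ s / Φ s₀ ∈ slitPlane} ∩
      {s | ‖f s - f s₀‖ < 1} := by
    have hmem : U ∩ {s | Φ s / Φ s₀ ∈ slitPlane} ∩ {s | ‖f s - f s₀‖ < 1} ∈ 𝓝 s₀ :=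
      Filter.inter_mem (Filter.inter_mem (hU.mem_nhds hs₀) hslit) hsmall
    exact Metric.mem_nhds_iff.1 hmem
  -- on the ball, `f = f s₀ + Log (Φ / Φ s₀)`
  set g : ℂ → ℂ := fun s ↦ f s₀ + log (Φ s / Φ s₀) with hg_def
  have hgd : DifferentiableOn ℂ g (ball s₀ r) := by
    intro s hs
    have hsU : s ∈ U := (hball hs).1.1
    have h1 : DifferentiableAt ℂ (fun s ↦ log (Φ s / Φ s₀)) s :=
      ((hΦ.differentiableAt (hU.mem_nhds hsU)).div_const _).clog (hball hs).1.2
    exact (h1.const_add (f s₀)).differentiableWithinAt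
  have heq : EqOn f g (ball s₀ r) := by
    refine eqOn_of_exp_eq_exp (convex_ball s₀ r).isPreconnected
      (hf.mono fun s hs ↦ (hball hs).1.1) hgd.continuousOn (fun s hs ↦ ?_) (mem_ball_self hr)
      (by simp [hg_def, div_self hΦ0])
    rw [hg_def]
    simp only
    rw [exp_add, exp_log (slitPlane_ne_zero (hball hs).1.2), he s₀ hs₀, he s (hball hs).1.1,
      mul_div_cancel₀ _ hΦ0]
  have hfd : DifferentiableAt ℂ f s₀ := by
    have hga : DifferentiableAt ℂ g s₀ := hgd.differentiableAt (ball_mem_nhds s₀ hr)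
    exact hga.congr_of_eventuallyEq (eventuallyEq_of_mem (ball_mem_nhds s₀ hr) heq)
  exact hfd.differentiableWithinAt

/-! ### The classical region and its constant -/

/-- The absolute constant `c̄ ∈ (0, 1/100]` of the tree's zero-free region with bounds
(`ZetaClassicalRegion.exists_zeroFreeRegion_bounds`). [cite: Titchmarsh1986, Theorem 3.11] -/
def zfrConst : ℝ := Classical.choose ZetaClassicalRegion.exists_zeroFreeRegion_bounds

/-- The defining package of `zfrConst`: `0 < c̄ ≤ 1/100` and the four bounds in
`σ ≥ 1 − 4c̄/log(|t| + 3)`. [cite: Titchmarsh1986, Theorem 3.11 (3.11.7)–(3.11.8)] -/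
theorem zfrConst_spec : 0 < zfrConst ∧ zfrConst ≤ 1 / 100 ∧ ∃ C : ℝ, 0 < C ∧ ∀ s : ℂ, s ≠ 1 →
      1 - 4 * zfrConst / Real.log (|s.im| + 3) ≤ s.re →
        riemannZeta s ≠ 0 ∧
        ‖riemannZeta s - 1 / (s - 1)‖ ≤ C * Real.log (|s.im| + 3) ∧
        ‖(riemannZeta s)⁻¹‖ ≤ C * Real.log (|s.im| + 3) ∧
        ‖deriv riemannZeta s / riemannZeta s + 1 / (s - 1)‖ ≤ C * Real.log (|s.im| + 3) :=
  Classical.choose_spec ZetaClassicalRegion.exists_zeroFreeRegion_bounds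

/-- `0 < c̄`. [folklore] -/
theorem zfrConst_pos : 0 < zfrConst := zfrConst_spec.1

/-- `c̄ ≤ 1/100`. [folklore] -/
theorem zfrConst_le : zfrConst ≤ 1 / 100 := zfrConst_spec.2.1

/-- The absolute implied constant `C > 0` of the bounds in the region.
[cite: Titchmarsh1986, Theorem 3.11] -/
def zfrBoundConst : ℝ := Classical.choose zfrConst_spec.2.2

/-- `0 < C`. [folklore] -/
theorem zfrBoundConst_pos : 0 < zfrBoundConst := (Classical.choose_spec zfrConst_spec.2.2).1

/-- The bounds in the region, with the fixed constants. [cite: Titchmarsh1986, Theorem 3.11] -/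
theorem zfr_bounds {s : ℂ} (hs1 : s ≠ 1)
    (hσ : 1 - 4 * zfrConst / Real.log (|s.im| + 3) ≤ s.re) :
    riemannZeta s ≠ 0 ∧
      ‖riemannZeta s - 1 / (s - 1)‖ ≤ zfrBoundConst * Real.log (|s.im| + 3) ∧
      ‖(riemannZeta s)⁻¹‖ ≤ zfrBoundConst * Real.log (|s.im| + 3) ∧
      ‖deriv riemannZeta s / riemannZeta s + 1 / (s - 1)‖ ≤
        zfrBoundConst * Real.log (|s.im| + 3) :=
  (Classical.choose_spec zfrConst_spec.2.2).2 s hs1 hσ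

/-- The width function `4c̄/log(|t| + 3)` of the region. [cite: Titchmarsh1986, Theorem 3.11] -/
def zfrWidth (t : ℝ) : ℝ := 4 * zfrConst / Real.log (|t| + 3)

/-- The width is positive. [folklore] -/
theorem zfrWidth_pos (t : ℝ) : 0 < zfrWidth t :=
  div_pos (mul_pos four_pos zfrConst_pos) (zero_lt_one.trans (ZetaClassicalRegion.one_lt_log_abs_add_three t))

/-- `zfrWidth t ≤ 4c̄ ≤ 1/25 < 1/2`. [folklore] -/
theorem zfrWidth_lt_half (t : ℝ) : zfrWidth t < 1 / 2 := by
  have h1 := ZetaClassicalRegion.one_lt_log_abs_add_three t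
  have h2 : zfrWidth t ≤ 4 * zfrConst := by
    unfold zfrWidth
    rw [div_le_iff₀ (by linarith)]
    nlinarith [zfrConst_pos]
  linarith [zfrConst_le]

/-- The width is even and decreasing in `|t|`. [folklore] -/
theorem zfrWidth_anti {t t' : ℝ} (h : |t'| ≤ |t|) : zfrWidth t ≤ zfrWidth t' := by
  unfold zfrWidth
  have h1 := ZetaClassicalRegion.one_lt_log_abs_add_three t'
  exact div_le_div_of_nonneg_left (mul_pos four_pos zfrConst_pos).le (by linarith)
    (Real.log_le_log (by linarith [abs_nonneg t']) (by linarith))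

/-- The width is continuous. [folklore] -/
theorem continuous_zfrWidth : Continuous zfrWidth := by
  have h1 : Continuous fun t : ℝ ↦ Real.log (|t| + 3) :=
    Continuous.log (by fun_prop) fun t ↦ by positivity
  exact continuous_const.div h1 fun t ↦ (zero_lt_one.trans (ZetaClassicalRegion.one_lt_log_abs_add_three t)).ne'

/-- **The classical region** `Ω = {s : Re s > 1 − 4c̄/log(|Im s| + 3)}`.
[cite: Titchmarsh1986, Theorem 3.11] -/
def zfrRegion : Set ℂ := {s : ℂ | 1 - zfrWidth s.im < s.re}

/-- Membership in the region, unfolded. [folklore] -/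
theorem mem_zfrRegion {s : ℂ} : s ∈ zfrRegion ↔ 1 - zfrWidth s.im < s.re := Iff.rfl

/-- The region is open. [folklore] -/
theorem isOpen_zfrRegion : IsOpen zfrRegion :=
  isOpen_lt (continuous_const.sub (continuous_zfrWidth.comp continuous_im)) continuous_re

/-- The closed half-plane `Re s ≥ 1` lies in the region. [folklore] -/
theorem mem_zfrRegion_of_one_le_re {s : ℂ} (hs : 1 ≤ s.re) : s ∈ zfrRegion := by
  rw [mem_zfrRegion]; linarith [zfrWidth_pos s.im]

/-- Points of the region have `Re s > 1/2`. [folklore] -/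
theorem half_lt_re_of_mem_zfrRegion {s : ℂ} (hs : s ∈ zfrRegion) : 1 / 2 < s.re := by
  rw [mem_zfrRegion] at hs; linarith [zfrWidth_lt_half s.im]

/-- A box criterion: `1 − 4c̄/log(T + 3) ≤ Re s` and `|Im s| ≤ T` force `s ∈ Ω` strictly inside,
indeed already `1 − 4c̄/log(T + 3) < Re s` does. [folklore] -/
theorem mem_zfrRegion_of_le {s : ℂ} {T : ℝ} (hT : |s.im| ≤ T)
    (hσ : 1 - 4 * zfrConst / Real.log (T + 3) < s.re) : s ∈ zfrRegion := by
  rw [mem_zfrRegion]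
  have : zfrWidth T ≤ zfrWidth s.im := zfrWidth_anti (by rw [abs_of_nonneg ((abs_nonneg _).trans hT)]; exact hT)
  have hT' : zfrWidth T = 4 * zfrConst / Real.log (T + 3) := by
    unfold zfrWidth; rw [abs_of_nonneg ((abs_nonneg _).trans hT)]
  linarith

/-- **The region is star-convex about `2`** (its width decreases with `|t|`), hence simply
connected. [folklore] -/
theorem starConvex_zfrRegion : StarConvex ℝ (2 : ℂ) zfrRegion := by
  intro s hs a b ha hb hab
  rw [mem_zfrRegion] at hs ⊢
  have him : (a • (2 : ℂ) + b • s).im = b * s.im := by simp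
  have hre : (a • (2 : ℂ) + b • s).re = 2 * a + b * s.re := by simp; ring
  rw [him, hre]
  have hb1 : b ≤ 1 := by linarith
  have hw : zfrWidth s.im ≤ zfrWidth (b * s.im) :=
    zfrWidth_anti (by rw [abs_mul, abs_of_nonneg hb]; exact mul_le_of_le_one_left (abs_nonneg _) hb1)
  have hQ : b * zfrWidth s.im ≤ zfrWidth (b * s.im) :=
    (mul_le_of_le_one_left (zfrWidth_pos _).le hb1).trans hw
  have key : 0 < a + (b * s.re - b + b * zfrWidth s.im) := by
    rcases hb.eq_or_lt with h | h
    · rw [← h] at hab ⊢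
      simp only [add_zero] at hab
      rw [hab]; norm_num
    · have hX : 0 < s.re - 1 + zfrWidth s.im := by linarith
      nlinarith [mul_pos h hX]
  linarith

/-- The region is simply connected (star-convex). [folklore] -/
theorem isSimplyConnected_zfrRegion : IsSimplyConnected zfrRegion := by
  have hne : zfrRegion.Nonempty := ⟨2, mem_zfrRegion_of_one_le_re (by norm_num)⟩
  have := starConvex_zfrRegion.contractibleSpace hne
  show SimplyConnectedSpace zfrRegion
  infer_instance

/-- `ζ₁ = (s − 1)ζ(s)` does not vanish on the region. [cite: Titchmarsh1986, Theorem 3.11] -/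
theorem riemannZeta₁_ne_zero_of_mem_zfrRegion {s : ℂ} (hs : s ∈ zfrRegion) :
    riemannZeta₁ s ≠ 0 := by
  by_cases h1 : s = 1
  · rw [h1, riemannZeta₁_one]; exact one_ne_zero
  rw [Ne, riemannZeta₁_eq_zero_iff h1]
  exact (zfr_bounds h1 (le_of_lt hs)).1

/-- `ζ` does not vanish on the region (off the pole). [cite: Titchmarsh1986, Theorem 3.11] -/
theorem riemannZeta_ne_zero_of_mem_zfrRegion {s : ℂ} (hs : s ∈ zfrRegion) (h1 : s ≠ 1) :
    riemannZeta s ≠ 0 :=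
  (zfr_bounds h1 (le_of_lt hs)).1

/-! ### The logarithm `log ζ₁` on the region -/

/-- `ζ₁(2) = ζ(2) = π²/6`. [folklore] -/
theorem riemannZeta₁_two : riemannZeta₁ 2 = ((Real.pi ^ 2 / 6 : ℝ) : ℂ) := by
  rw [riemannZeta₁_eq_mul (by norm_num : (2 : ℂ) ≠ 1), riemannZeta_two]
  push_cast
  ring

/-- `0 < π²/6`. [folklore] -/
theorem riemannZeta₁_two_pos : 0 < Real.pi ^ 2 / 6 := by positivity

/-- Existence of a continuous (hence holomorphic) logarithm of `ζ₁` on the region, normalised at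
`s = 2`. [folklore] -/
theorem exists_logZeta₁ : ∃ L : ℂ → ℂ, ContinuousOn L zfrRegion ∧
    (∀ s ∈ zfrRegion, exp (L s) = riemannZeta₁ s) ∧ L 2 = log (riemannZeta₁ 2) := by
  obtain ⟨f, hfc, hfe⟩ := Complex.exists_continuousOn_eqOn_exp_comp isSimplyConnected_zfrRegion
    isOpen_zfrRegion differentiable_riemannZeta₁.continuous.continuousOn (by
      rintro ⟨s, hs, h0⟩
      exact riemannZeta₁_ne_zero_of_mem_zfrRegion hs h0)
  have h2 : (2 : ℂ) ∈ zfrRegion := mem_zfrRegion_of_one_le_re (by norm_num)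
  refine ⟨fun s ↦ f s - f 2 + log (riemannZeta₁ 2), (hfc.sub continuousOn_const).add
    continuousOn_const, fun s hs ↦ ?_, by simp⟩
  have e1 : exp (f s) = riemannZeta₁ s := hfe hs
  have e2 : exp (f 2) = riemannZeta₁ 2 := hfe h2
  have hne : riemannZeta₁ 2 ≠ 0 := riemannZeta₁_ne_zero_of_mem_zfrRegion h2
  simp only
  rw [exp_add, exp_sub, e1, e2, exp_log hne, div_mul_cancel₀ _ hne]

/-- **`log ζ₁` on the classical region**: the holomorphic branch of `log((s − 1)ζ(s))` on
`Ω = zfrRegion` with `logZeta₁ 2 = log ζ(2) = log(π²/6)` real. [cite: Tenenbaum2015, II.5 §5.1] -/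
def logZeta₁ : ℂ → ℂ := Classical.choose exists_logZeta₁

/-- `logZeta₁` is continuous on the region. [folklore] -/
theorem continuousOn_logZeta₁ : ContinuousOn logZeta₁ zfrRegion :=
  (Classical.choose_spec exists_logZeta₁).1

/-- `exp (logZeta₁ s) = ζ₁(s)` on the region. [folklore] -/
theorem exp_logZeta₁ {s : ℂ} (hs : s ∈ zfrRegion) : exp (logZeta₁ s) = riemannZeta₁ s :=
  (Classical.choose_spec exists_logZeta₁).2.1 s hs

/-- The normalisation `logZeta₁ 2 = Log ζ₁(2)`. [folklore] -/
theorem logZeta₁_two : logZeta₁ 2 = log (riemannZeta₁ 2) :=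
  (Classical.choose_spec exists_logZeta₁).2.2

/-- The normalisation is real: `logZeta₁ 2 = log(π²/6)`. [folklore] -/
theorem logZeta₁_two_eq_ofReal : logZeta₁ 2 = ((Real.log (Real.pi ^ 2 / 6) : ℝ) : ℂ) := by
  rw [logZeta₁_two, riemannZeta₁_two, ofReal_log riemannZeta₁_two_pos.le]

/-- `logZeta₁` is holomorphic on the region. [folklore] -/
theorem differentiableOn_logZeta₁ : DifferentiableOn ℂ logZeta₁ zfrRegion :=
  differentiableOn_of_exp_eq isOpen_zfrRegion differentiable_riemannZeta₁.differentiableOn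
    continuousOn_logZeta₁ fun _ hs ↦ exp_logZeta₁ hs

/-- `logZeta₁` has derivative `ζ₁'/ζ₁` on the region. [folklore] -/
theorem hasDerivAt_logZeta₁ {s : ℂ} (hs : s ∈ zfrRegion) :
    HasDerivAt logZeta₁ (deriv riemannZeta₁ s / riemannZeta₁ s) s := by
  have hd : DifferentiableAt ℂ logZeta₁ s :=
    differentiableOn_logZeta₁.differentiableAt (isOpen_zfrRegion.mem_nhds hs)
  have hL := hd.hasDerivAt
  -- differentiate `exp ∘ logZeta₁ = ζ₁` near `s`
  have heq : (fun z ↦ exp (logZeta₁ z)) =ᶠ[𝓝 s] riemannZeta₁ :=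
    eventuallyEq_of_mem (isOpen_zfrRegion.mem_nhds hs) fun z hz ↦ exp_logZeta₁ hz
  have h1 : HasDerivAt (fun z ↦ exp (logZeta₁ z)) (exp (logZeta₁ s) * deriv logZeta₁ s) s :=
    hL.cexp
  have h2 : deriv riemannZeta₁ s = exp (logZeta₁ s) * deriv logZeta₁ s := by
    rw [← heq.deriv_eq]; exact h1.deriv
  rw [h2, exp_logZeta₁ hs, mul_div_cancel_left₀ _ (riemannZeta₁_ne_zero_of_mem_zfrRegion hs)]
  exact hL

/-! ### The Euler-product logarithm on `Re s > 1` and the identification -/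

/-- The Euler-product logarithm `∑_p −Log(1 − p^{−s})` of `ζ(s)` (`Re s > 1`; Mathlib's
`riemannZeta_eulerProduct_exp_log` gives `exp` of it `= ζ(s)`). [folklore] -/
def eulerLogZeta (s : ℂ) : ℂ := ∑' p : Nat.Primes, -log (1 - (p : ℂ) ^ (-s))

/-- `exp` of the Euler logarithm is `ζ(s)` (`Re s > 1`). [folklore] -/
theorem exp_eulerLogZeta {s : ℂ} (hs : 1 < s.re) : exp (eulerLogZeta s) = riemannZeta s :=
  riemannZeta_eulerProduct_exp_log hs

/-- For `Re s ≥ σ₁ > 1`: `‖p^{−s}‖ ≤ p^{−σ₁} ≤ 1/2`. [folklore] -/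
theorem norm_primes_cpow_neg_le_of_le_re {p : Nat.Primes} {s : ℂ} {σ₁ : ℝ} (hσ₁ : 1 < σ₁) (hs : σ₁ ≤ s.re) :
    ‖(p : ℂ) ^ (-s)‖ ≤ (p : ℝ) ^ (-σ₁) ∧ (p : ℝ) ^ (-σ₁) ≤ 1 / 2 := by
  have hp : (2 : ℝ) ≤ p := by exact_mod_cast p.prop.two_le
  rw [norm_prime_cpow_neg]
  refine ⟨Real.rpow_le_rpow_of_exponent_le (by linarith) (by linarith), ?_⟩
  calc (p : ℝ) ^ (-σ₁) ≤ (p : ℝ) ^ (-1 : ℝ) :=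
        Real.rpow_le_rpow_of_exponent_le (by linarith) (by linarith)
    _ = 1 / p := by rw [Real.rpow_neg_one, one_div]
    _ ≤ 1 / 2 := div_le_div_of_nonneg_left zero_le_one two_pos hp

/-- The Euler logarithm is holomorphic on `Re s > 1` (locally uniform convergence:
`‖Log(1 − p^{−s})‖ ≤ (3/2) p^{−σ₁}` on `Re s > σ₁ > 1`). [folklore] -/
theorem differentiableOn_eulerLogZeta : DifferentiableOn ℂ eulerLogZeta {s : ℂ | 1 < s.re} := by
  intro s hs
  obtain ⟨σ₁, hσ₁, hσs⟩ : ∃ σ₁ : ℝ, 1 < σ₁ ∧ σ₁ < s.re := exists_between hs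
  have hUo : IsOpen {z : ℂ | σ₁ < z.re} := isOpen_lt continuous_const continuous_re
  suffices h : DifferentiableOn ℂ eulerLogZeta {z : ℂ | σ₁ < z.re} from
    (h.differentiableAt (hUo.mem_nhds hσs)).differentiableWithinAt
  have hsum : Summable fun p : Nat.Primes ↦ (3 / 2 : ℝ) * (p : ℝ) ^ (-σ₁) :=
    ((Nat.Primes.summable_rpow (r := -σ₁)).2 (by linarith)).mul_left _
  refine differentiableOn_tsum_of_summable_norm hsum (fun p z hz ↦ ?_) hUo (fun p z hz ↦ ?_)
  · -- each term is holomorphic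
    have hz : σ₁ < z.re := hz
    obtain ⟨h1, h2⟩ := norm_primes_cpow_neg_le_of_le_re (p := p) hσ₁ hz.le
    have hslit : 1 - (p : ℂ) ^ (-z) ∈ slitPlane := by
      left
      have : ((p : ℂ) ^ (-z)).re ≤ ‖(p : ℂ) ^ (-z)‖ := re_le_norm _
      simp only [sub_re, one_re]
      linarith
    have hd : DifferentiableAt ℂ (fun w ↦ 1 - (p : ℂ) ^ (-w)) z :=
      (differentiableAt_const _).sub (differentiableAt_id.neg.const_cpow
        (Or.inl (by exact_mod_cast p.prop.ne_zero)))
    exact (hd.clog hslit).neg.differentiableWithinAt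
  · have hz : σ₁ < z.re := hz
    obtain ⟨h1, h2⟩ := norm_primes_cpow_neg_le_of_le_re (p := p) hσ₁ hz.le
    rw [norm_neg, sub_eq_add_neg]
    calc ‖log (1 + -(p : ℂ) ^ (-z))‖ ≤ 3 / 2 * ‖-(p : ℂ) ^ (-z)‖ :=
          norm_log_one_add_half_le_self (by rw [norm_neg]; linarith)
      _ ≤ 3 / 2 * (p : ℝ) ^ (-σ₁) := by rw [norm_neg]; linarith

/-- Each Euler logarithm at a real point `σ > 1` is real: `eulerLogZeta σ = log ζ(σ)` as real
numbers. [folklore] -/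
theorem eulerLogZeta_two : eulerLogZeta 2 = log (riemannZeta 2) := by
  -- both are real logarithms of the positive real `ζ(2)`
  have hreal : ∀ p : Nat.Primes, -log (1 - (p : ℂ) ^ (-(2 : ℂ))) =
      ((-Real.log (1 - (p : ℝ) ^ (-(2 : ℝ))) : ℝ) : ℂ) := by
    intro p
    have hp : (2 : ℝ) ≤ p := by exact_mod_cast p.prop.two_le
    have hlt : (p : ℝ) ^ (-(2 : ℝ)) < 1 :=
      Real.rpow_lt_one_of_one_lt_of_neg (by linarith) (by norm_num)
    have hcast : (p : ℂ) ^ (-(2 : ℂ)) = (((p : ℝ) ^ (-(2 : ℝ)) : ℝ) : ℂ) := by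
      rw [ofReal_cpow (by linarith : (0 : ℝ) ≤ p)]; push_cast; ring_nf
    rw [hcast, ← ofReal_one, ← ofReal_sub, ← ofReal_log (by linarith), ofReal_neg]
  have hsumC : Summable fun p : Nat.Primes ↦ -log (1 - (p : ℂ) ^ (-(2 : ℂ))) := by
    have := DirichletCharacter.summable_neg_log_one_sub_mul_prime_cpow
      (1 : DirichletCharacter ℂ 1) (s := 2) (by norm_num)
    simpa only [MulChar.one_apply (isUnit_of_subsingleton _), one_mul] using this
  have h1 : eulerLogZeta 2 = ((∑' p : Nat.Primes, -Real.log (1 - (p : ℝ) ^ (-(2 : ℝ))) : ℝ) : ℂ) := by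
    rw [eulerLogZeta, ofReal_tsum]
    exact tsum_congr hreal
  have hζ : riemannZeta 2 = ((Real.pi ^ 2 / 6 : ℝ) : ℂ) := by rw [riemannZeta_two]; push_cast; ring
  have h2 : log (riemannZeta 2) = ((Real.log (Real.pi ^ 2 / 6)) : ℂ) := by
    rw [hζ, ofReal_log riemannZeta₁_two_pos.le]
  -- compare the real exponentials
  have hexp : exp (eulerLogZeta 2) = exp (log (riemannZeta 2)) := by
    rw [exp_eulerLogZeta (by norm_num), exp_log]
    rw [hζ]; exact_mod_cast riemannZeta₁_two_pos.ne'
  rw [h1, h2] at hexp ⊢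
  rw [← ofReal_exp, ← ofReal_exp, ofReal_inj] at hexp
  rw [Real.exp_eq_exp.1 hexp]

/-- **Identification on `Re s > 1`**: `logZeta₁ s = ∑_p −Log(1 − p^{−s}) + Log(s − 1)`.
[cite: Tenenbaum2015, II.5 §5.1] -/
theorem logZeta₁_eq_eulerLogZeta_add_log {s : ℂ} (hs : 1 < s.re) :
    logZeta₁ s = eulerLogZeta s + log (s - 1) := by
  set U : Set ℂ := {z : ℂ | 1 < z.re} with hU
  have hUsub : U ⊆ zfrRegion := fun z hz ↦ mem_zfrRegion_of_one_le_re (le_of_lt hz)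
  have hconv : Convex ℝ U := convex_halfSpace_re_gt 1
  have hne1 : ∀ z ∈ U, z - 1 ≠ 0 := fun z hz h ↦ by
    have : z.re = 1 := by rw [sub_eq_zero.1 h]; simp
    exact absurd hz (by rw [hU]; simp [this])
  have hslit : ∀ z ∈ U, z - 1 ∈ slitPlane := fun z hz ↦ Or.inl (by simp; linarith [show 1 < z.re from hz])
  have hg : ContinuousOn (fun z ↦ eulerLogZeta z + log (z - 1)) U :=
    (differentiableOn_eulerLogZeta.continuousOn).add (ContinuousOn.clog (by fun_prop) hslit)
  refine eqOn_of_exp_eq_exp hconv.isPreconnected (continuousOn_logZeta₁.mono hUsub) hg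
    (fun z hz ↦ ?_) (show (2 : ℂ) ∈ U by simp [hU]) ?_ hs
  · show exp (logZeta₁ z) = exp (eulerLogZeta z + log (z - 1))
    rw [exp_logZeta₁ (hUsub hz), exp_add, exp_eulerLogZeta hz, exp_log (hne1 z hz),
      riemannZeta₁_eq_mul (fun h ↦ hne1 z hz (by rw [h, sub_self])), mul_comm]
  · show logZeta₁ 2 = eulerLogZeta 2 + log (2 - 1)
    rw [logZeta₁_two, eulerLogZeta_two, riemannZeta₁_eq_mul (by norm_num)]
    norm_num

/-! ### Reality on the real axis -/

/-- `ζ₁` commutes with complex conjugation. [folklore] -/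
theorem riemannZeta₁_conj (s : ℂ) : riemannZeta₁ (starRingEnd ℂ s) = starRingEnd ℂ (riemannZeta₁ s) := by
  by_cases h1 : s = 1
  · rw [h1, map_one, riemannZeta₁_one, map_one]
  have h1' : starRingEnd ℂ s ≠ 1 := fun h ↦ h1 (by rw [← RingHom.map_one (starRingEnd ℂ)] at h; exact star_injective h)
  rw [riemannZeta₁_eq_mul h1', riemannZeta₁_eq_mul h1, riemannZeta_conj, map_mul, map_sub, map_one]

/-- `logZeta₁` is real on the real points of the region. [folklore] -/
theorem logZeta₁_ofReal_im {x : ℝ} (hx : (x : ℂ) ∈ zfrRegion) : (logZeta₁ x).im = 0 := by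
  -- the real trace of the region is a (convex) segment containing `2`
  set R : Set ℂ := {s : ℂ | s.im = 0 ∧ 1 - zfrWidth 0 < s.re} with hR
  have hRsub : R ⊆ zfrRegion := by
    rintro s ⟨hsi, hsr⟩; rw [mem_zfrRegion, hsi]; exact hsr
  have hxR : (x : ℂ) ∈ R := by
    refine ⟨ofReal_im x, ?_⟩
    have := hx; rw [mem_zfrRegion, ofReal_im] at this; simpa using this
  have h2R : (2 : ℂ) ∈ R := ⟨by simp, by simp; linarith [zfrWidth_pos 0, zfrWidth_lt_half 0]⟩
  have hconv : Convex ℝ R := by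
    have : R = {s : ℂ | s.im = 0} ∩ {s : ℂ | 1 - zfrWidth 0 < s.re} := rfl
    rw [this]
    refine Convex.inter ?_ (convex_halfSpace_re_gt _)
    have h := convex_halfSpace_im_le (0 : ℝ)
    have h' := convex_halfSpace_im_ge (0 : ℝ)
    convert h.inter h' using 1
    ext s; simp [le_antisymm_iff]
  -- `h = L − conj L` has `exp h = 1` on `R` and vanishes at `2`
  set h : ℂ → ℂ := fun s ↦ logZeta₁ s - starRingEnd ℂ (logZeta₁ s) with hh
  have hcont : ContinuousOn h R :=
    (continuousOn_logZeta₁.mono hRsub).sub (continuous_conj.comp_continuousOn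
      (continuousOn_logZeta₁.mono hRsub))
  have hexp : ∀ s ∈ R, exp (h s) = 1 := by
    intro s hs
    have hsreal : starRingEnd ℂ s = s := by
      apply Complex.ext <;> simp [hs.1]
    have hζ : starRingEnd ℂ (riemannZeta₁ s) = riemannZeta₁ s := by
      rw [← riemannZeta₁_conj, hsreal]
    rw [hh]; simp only
    rw [exp_sub, exp_conj, exp_logZeta₁ (hRsub hs), hζ,
      div_self (riemannZeta₁_ne_zero_of_mem_zfrRegion (hRsub hs))]
  have h20 : h 2 = 0 := by
    rw [hh]; simp only
    rw [logZeta₁_two_eq_ofReal, conj_ofReal, sub_self]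
  have hz := eqOn_zero_of_exp_eq_one hconv.isPreconnected hcont hexp h2R h20 hxR
  simp only [hh, Pi.zero_apply, sub_eq_zero] at hz
  -- `L = conj L` forces `Im L = 0`
  have := congrArg Complex.im hz
  rw [conj_im] at this
  linarith

/-- Hence on real points `x` of the region `exp (logZeta₁ x) = ζ₁(x)` is a positive real and
`Re (logZeta₁ x) = log ζ₁(x)`. [folklore] -/
theorem exp_re_logZeta₁_ofReal {x : ℝ} (hx : (x : ℂ) ∈ zfrRegion) :
    Real.exp (logZeta₁ x).re = ‖riemannZeta₁ x‖ := by
  rw [← exp_logZeta₁ hx, norm_exp]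

/-! ### The complex powers `ζ(s)^μ` -/

/-- **The branch of `ζ(s)^μ`** (`μ` real) on the region slit along `(−∞, 1]`:
`zetaCpow μ s = exp(μ · logZeta₁ s) · (s − 1)^{−μ}` (principal power). On `Re s > 1` this is
`exp(μ ∑_p −Log(1 − p^{−s}))` (`zetaCpow_eq_exp_eulerLogZeta`).
[cite: Tenenbaum2015, II.5 §5.1] [cite: Montgomery1983, §3 (f*(s))] -/
def zetaCpow (μ : ℝ) (s : ℂ) : ℂ := exp (μ * logZeta₁ s) * (s - 1) ^ (-(μ : ℂ))

/-- The slit region `Ω ∖ (−∞, 1]` on which `zetaCpow μ` is holomorphic. [folklore] -/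
def zfrSlitRegion : Set ℂ := zfrRegion ∩ {s : ℂ | s - 1 ∈ slitPlane}

/-- The slit region is open. [folklore] -/
theorem isOpen_zfrSlitRegion : IsOpen zfrSlitRegion :=
  isOpen_zfrRegion.inter (isOpen_slitPlane.preimage (continuous_id.sub continuous_const))

/-- Points of the region off the real axis lie in the slit region. [folklore] -/
theorem mem_zfrSlitRegion_of_im_ne_zero {s : ℂ} (hs : s ∈ zfrRegion) (him : s.im ≠ 0) :
    s ∈ zfrSlitRegion :=
  ⟨hs, Or.inr (by simpa using him)⟩

/-- The half-plane `Re s > 1` lies in the slit region. [folklore] -/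
theorem mem_zfrSlitRegion_of_one_lt_re {s : ℂ} (hs : 1 < s.re) : s ∈ zfrSlitRegion :=
  ⟨mem_zfrRegion_of_one_le_re hs.le, Or.inl (by simp; linarith)⟩

/-- `zetaCpow μ` is holomorphic on the slit region. [folklore] -/
theorem differentiableOn_zetaCpow (μ : ℝ) : DifferentiableOn ℂ (zetaCpow μ) zfrSlitRegion := by
  intro s hs
  have hL : DifferentiableAt ℂ logZeta₁ s :=
    differentiableOn_logZeta₁.differentiableAt (isOpen_zfrRegion.mem_nhds hs.1)
  have h1 : DifferentiableAt ℂ (fun z ↦ exp (μ * logZeta₁ z)) s := (hL.const_mul _).cexp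
  have h2 : DifferentiableAt ℂ (fun z : ℂ ↦ (z - 1) ^ (-(μ : ℂ))) s :=
    (differentiableAt_id.sub_const 1).cpow_const hs.2
  exact (h1.mul h2).differentiableWithinAt

/-- `zetaCpow μ` is continuous on the slit region. [folklore] -/
theorem continuousOn_zetaCpow (μ : ℝ) : ContinuousOn (zetaCpow μ) zfrSlitRegion :=
  (differentiableOn_zetaCpow μ).continuousOn

/-- On `Re s > 1`: `zetaCpow μ s = exp(μ · ∑_p −Log(1 − p^{−s}))`, i.e. the power of the Euler
product. [cite: Tenenbaum2015, II.5 §5.1] -/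
theorem zetaCpow_eq_exp_eulerLogZeta {μ : ℝ} {s : ℂ} (hs : 1 < s.re) :
    zetaCpow μ s = exp (μ * eulerLogZeta s) := by
  have hne : s - 1 ≠ 0 := fun h ↦ by
    have : s.re = 1 := by rw [sub_eq_zero.1 h]; simp
    linarith
  rw [zetaCpow, logZeta₁_eq_eulerLogZeta_add_log hs, cpow_def_of_ne_zero hne, mul_add, exp_add,
    mul_assoc, ← exp_add]
  have : (μ : ℂ) * log (s - 1) + log (s - 1) * -(μ : ℂ) = 0 := by ring
  rw [this, exp_zero, mul_one]

/-- **The modulus is branch-free**: `‖zetaCpow μ s‖ = ‖ζ(s)‖^μ` for `s ∈ Ω`, `s ≠ 1`.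
[folklore] -/
theorem norm_zetaCpow {μ : ℝ} {s : ℂ} (hs : s ∈ zfrRegion) (h1 : s ≠ 1) :
    ‖zetaCpow μ s‖ = ‖riemannZeta s‖ ^ μ := by
  have hne : s - 1 ≠ 0 := sub_ne_zero.2 h1
  have hpos : 0 < ‖s - 1‖ := norm_pos_iff.2 hne
  rw [zetaCpow, norm_mul, norm_exp, ← ofReal_neg, Complex.norm_cpow_real, re_ofReal_mul,
    mul_comm μ, Real.exp_mul, ← norm_exp, exp_logZeta₁ hs, riemannZeta₁_eq_mul h1, norm_mul,
    Real.mul_rpow (norm_nonneg _) (norm_nonneg _), Real.rpow_neg (norm_nonneg _)]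
  field_simp

/-- `zetaCpow μ s ≠ 0` off the branch point. [folklore] -/
theorem zetaCpow_ne_zero (μ : ℝ) {s : ℂ} (h1 : s ≠ 1) : zetaCpow μ s ≠ 0 := by
  refine mul_ne_zero (exp_ne_zero _) ?_
  rw [cpow_def_of_ne_zero (sub_ne_zero.2 h1)]
  exact exp_ne_zero _

/-- For `μ ≥ 0`: `‖ζ(s)^μ‖ ≤ (C log(|t| + 3) + 1/‖s − 1‖)^μ` in the region.
[cite: Titchmarsh1986, Theorem 3.11 (3.11.8)] -/
theorem norm_zetaCpow_le_of_nonneg {μ : ℝ} (hμ : 0 ≤ μ) {s : ℂ} (hs : s ∈ zfrRegion) (h1 : s ≠ 1) :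
    ‖zetaCpow μ s‖ ≤ (zfrBoundConst * Real.log (|s.im| + 3) + 1 / ‖s - 1‖) ^ μ := by
  rw [norm_zetaCpow hs h1]
  refine Real.rpow_le_rpow (norm_nonneg _) ?_ hμ
  have h := (zfr_bounds h1 (le_of_lt hs)).2.1
  calc ‖riemannZeta s‖ ≤ ‖riemannZeta s - 1 / (s - 1)‖ + ‖1 / (s - 1)‖ := norm_le_norm_sub_add _ _
    _ ≤ zfrBoundConst * Real.log (|s.im| + 3) + 1 / ‖s - 1‖ := by
        rw [norm_div, norm_one]; exact add_le_add h le_rfl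

/-- For `μ ≤ 0`: `‖ζ(s)^μ‖ = ‖1/ζ(s)‖^{−μ} ≤ (C log(|t| + 3))^{−μ}` in the region.
[cite: Titchmarsh1986, Theorem 3.11 (3.11.7)] -/
theorem norm_zetaCpow_le_of_nonpos {μ : ℝ} (hμ : μ ≤ 0) {s : ℂ} (hs : s ∈ zfrRegion) (h1 : s ≠ 1) :
    ‖zetaCpow μ s‖ ≤ (zfrBoundConst * Real.log (|s.im| + 3)) ^ (-μ) := by
  rw [norm_zetaCpow hs h1]
  have hζ : riemannZeta s ≠ 0 := riemannZeta_ne_zero_of_mem_zfrRegion hs h1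
  have h := (zfr_bounds h1 (le_of_lt hs)).2.2.1
  rw [norm_inv] at h
  calc ‖riemannZeta s‖ ^ μ = (‖riemannZeta s‖⁻¹) ^ (-μ) := by
        rw [Real.inv_rpow (norm_nonneg _), ← Real.rpow_neg (norm_nonneg _), neg_neg]
    _ ≤ (zfrBoundConst * Real.log (|s.im| + 3)) ^ (-μ) :=
        Real.rpow_le_rpow (inv_nonneg.2 (norm_nonneg _)) h (by linarith)

/-! ### Boundary values along the cut `(1 − c̄', 1)` -/

/-- The value of the smooth factor on the cut: for real `x` in the region,
`exp(μ · logZeta₁ x) = ‖ζ₁(x)‖^μ` is a positive real. [folklore] -/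
theorem exp_mul_logZeta₁_ofReal {μ x : ℝ} (hx : (x : ℂ) ∈ zfrRegion) :
    exp (μ * logZeta₁ x) = ((‖riemannZeta₁ x‖ ^ μ : ℝ) : ℂ) := by
  have him := logZeta₁_ofReal_im hx
  have hre : logZeta₁ x = ((logZeta₁ x).re : ℂ) := by
    apply Complex.ext <;> simp [him]
  rw [hre, ← ofReal_mul, ← ofReal_exp, ← exp_re_logZeta₁_ofReal hx, ← Real.exp_mul, mul_comm]

/-- **Upper boundary value on the cut**: as `s → x ∈ (1 − c̄', 1)` from `Im s > 0`,
`ζ(s)^μ → e^{−iπμ} (1 − x)^{−μ} ‖ζ₁(x)‖^μ`. [cite: Tenenbaum2015, II.5 §5.1 (the Hankel contour)] -/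
theorem tendsto_zetaCpow_upper {μ x : ℝ} (hx : (x : ℂ) ∈ zfrRegion) (hx1 : x < 1) :
    Tendsto (zetaCpow μ) (𝓝[{s : ℂ | 0 ≤ s.im}] (x : ℂ))
      (𝓝 (((‖riemannZeta₁ x‖ ^ μ * (1 - x) ^ (-μ) : ℝ) : ℂ) * exp (-(Real.pi * μ) * I))) := by
  -- the smooth factor is continuous at `x`
  have hL : ContinuousAt logZeta₁ x :=
    continuousOn_logZeta₁.continuousAt (isOpen_zfrRegion.mem_nhds hx)
  have h1 : Tendsto (fun s ↦ exp (μ * logZeta₁ s)) (𝓝[{s : ℂ | 0 ≤ s.im}] (x : ℂ))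
      (𝓝 (exp (μ * logZeta₁ x))) :=
    ((hL.const_mul (μ : ℂ)).cexp).tendsto.mono_left nhdsWithin_le_nhds
  -- the power `(s − 1)^{−μ} = exp(−μ Log(s − 1))` from above
  have hre : ((x : ℂ) - 1).re < 0 := by simp; linarith
  have him : ((x : ℂ) - 1).im = 0 := by simp
  have hlog := tendsto_log_nhdsWithin_im_nonneg_of_re_neg_of_im_zero hre him
  have hmap : Tendsto (fun s : ℂ ↦ s - 1) (𝓝[{s : ℂ | 0 ≤ s.im}] (x : ℂ))
      (𝓝[{s : ℂ | 0 ≤ s.im}] ((x : ℂ) - 1)) := by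
    refine tendsto_nhdsWithin_of_tendsto_nhds_of_eventually_within _
      ((continuous_id.sub continuous_const).tendsto _ |>.mono_left nhdsWithin_le_nhds) ?_
    filter_upwards [self_mem_nhdsWithin] with s hs
    simpa using hs
  have h2 : Tendsto (fun s : ℂ ↦ (s - 1) ^ (-(μ : ℂ))) (𝓝[{s : ℂ | 0 ≤ s.im}] (x : ℂ))
      (𝓝 (exp ((Real.log ‖(x : ℂ) - 1‖ + Real.pi * I) * -(μ : ℂ)))) := by
    have hev : ∀ᶠ s in 𝓝[{s : ℂ | 0 ≤ s.im}] (x : ℂ), exp (log (s - 1) * -(μ : ℂ)) = (s - 1) ^ (-(μ : ℂ)) := by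
      have hne : ∀ᶠ s in 𝓝 (x : ℂ), s - 1 ≠ 0 := by
        have : (x : ℂ) - 1 ≠ 0 := fun h ↦ by rw [h] at hre; simp at hre
        exact ((continuous_id.sub continuous_const).continuousAt (x := (x : ℂ))).eventually_ne this
      filter_upwards [mem_nhdsWithin_of_mem_nhds hne] with s hs
      rw [cpow_def_of_ne_zero hs]
    refine Tendsto.congr' hev ?_
    exact ((hlog.comp hmap).mul tendsto_const_nhds).cexp
  have h3 := h1.mul h2
  refine h3.congr' (Eventually.of_forall fun s ↦ rfl) |>.trans ?_
  -- identify the limit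
  apply le_of_eq; congr 1
  rw [exp_mul_logZeta₁_ofReal hx]
  have hn : ‖(x : ℂ) - 1‖ = 1 - x := by
    rw [← ofReal_one, ← ofReal_sub, norm_real, Real.norm_eq_abs, abs_of_neg (by linarith)]; ring
  rw [hn, add_mul, exp_add]
  have e1 : exp ((Real.log (1 - x) : ℂ) * -(μ : ℂ)) = (((1 - x) ^ (-μ) : ℝ) : ℂ) := by
    rw [Real.rpow_def_of_pos (by linarith), ofReal_exp]; push_cast; ring_nf
  rw [e1]; push_cast; ring_nf

/-- **Lower boundary value on the cut**: as `s → x ∈ (1 − c̄', 1)` from `Im s < 0`,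
`ζ(s)^μ → e^{+iπμ} (1 − x)^{−μ} ‖ζ₁(x)‖^μ`. [cite: Tenenbaum2015, II.5 §5.1 (the Hankel contour)] -/
theorem tendsto_zetaCpow_lower {μ x : ℝ} (hx : (x : ℂ) ∈ zfrRegion) (hx1 : x < 1) :
    Tendsto (zetaCpow μ) (𝓝[{s : ℂ | s.im < 0}] (x : ℂ))
      (𝓝 (((‖riemannZeta₁ x‖ ^ μ * (1 - x) ^ (-μ) : ℝ) : ℂ) * exp ((Real.pi * μ) * I))) := by
  have hL : ContinuousAt logZeta₁ x :=
    continuousOn_logZeta₁.continuousAt (isOpen_zfrRegion.mem_nhds hx)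
  have h1 : Tendsto (fun s ↦ exp (μ * logZeta₁ s)) (𝓝[{s : ℂ | s.im < 0}] (x : ℂ))
      (𝓝 (exp (μ * logZeta₁ x))) :=
    ((hL.const_mul (μ : ℂ)).cexp).tendsto.mono_left nhdsWithin_le_nhds
  have hre : ((x : ℂ) - 1).re < 0 := by simp; linarith
  have him : ((x : ℂ) - 1).im = 0 := by simp
  have hlog := tendsto_log_nhdsWithin_im_neg_of_re_neg_of_im_zero hre him
  have hmap : Tendsto (fun s : ℂ ↦ s - 1) (𝓝[{s : ℂ | s.im < 0}] (x : ℂ))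
      (𝓝[{s : ℂ | s.im < 0}] ((x : ℂ) - 1)) := by
    refine tendsto_nhdsWithin_of_tendsto_nhds_of_eventually_within _
      ((continuous_id.sub continuous_const).tendsto _ |>.mono_left nhdsWithin_le_nhds) ?_
    filter_upwards [self_mem_nhdsWithin] with s hs
    simpa using hs
  have h2 : Tendsto (fun s : ℂ ↦ (s - 1) ^ (-(μ : ℂ))) (𝓝[{s : ℂ | s.im < 0}] (x : ℂ))
      (𝓝 (exp ((Real.log ‖(x : ℂ) - 1‖ - Real.pi * I) * -(μ : ℂ)))) := by
    have hev : ∀ᶠ s in 𝓝[{s : ℂ | s.im < 0}] (x : ℂ), exp (log (s - 1) * -(μ : ℂ)) = (s - 1) ^ (-(μ : ℂ)) := by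
      have hne : ∀ᶠ s in 𝓝 (x : ℂ), s - 1 ≠ 0 := by
        have : (x : ℂ) - 1 ≠ 0 := fun h ↦ by rw [h] at hre; simp at hre
        exact ((continuous_id.sub continuous_const).continuousAt (x := (x : ℂ))).eventually_ne this
      filter_upwards [mem_nhdsWithin_of_mem_nhds hne] with s hs
      rw [cpow_def_of_ne_zero hs]
    refine Tendsto.congr' hev ?_
    exact ((hlog.comp hmap).mul tendsto_const_nhds).cexp
  have h3 := h1.mul h2
  refine h3.congr' (Eventually.of_forall fun s ↦ rfl) |>.trans ?_
  apply le_of_eq; congr 1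
  rw [exp_mul_logZeta₁_ofReal hx]
  have hn : ‖(x : ℂ) - 1‖ = 1 - x := by
    rw [← ofReal_one, ← ofReal_sub, norm_real, Real.norm_eq_abs, abs_of_neg (by linarith)]; ring
  rw [hn, sub_mul, exp_sub]
  have e1 : exp ((Real.log (1 - x) : ℂ) * -(μ : ℂ)) = (((1 - x) ^ (-μ) : ℝ) : ℂ) := by
    rw [Real.rpow_def_of_pos (by linarith), ofReal_exp]; push_cast; ring_nf
  rw [e1, div_eq_mul_inv, ← exp_neg]; push_cast; ring_nf

end Literature.NumberTheory.LFunctions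

end
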